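import Summits.CriticalPhenomena.PercolationContinuityZ3.Theorems.SahiMasterFamilyUCBernstein
import Summits.CriticalPhenomena.PercolationContinuityZ3.Theorems.SahiMasterFamilyPhiCapClosedForm
import Mathlib.Data.Complex.Basic
import Mathlib.Topology.Order.IntermediateValue

/-!
# The SECTOR-STABILITY conjecture (S) for Sahi's functional on the union-closed cone, typed, and the kernel reduction
# (S)_n ⟹ (UC-hull)_n (hence ⟹ (GH)_n = PC-n), every order

Unit `prim-masterthm-p4` (gen 23; crux anchor stmt-CriticalPhenomena-4575, helper work; memo
`run/shared/lean/prim/prim-masterthm/prim-masterthm-p4/P4-GEN23-REPORT.md` §1–§3).  Companion of `…UCBernstein` (patchwork decomposition,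
typed conjecture (B) `UCBernsteinNonneg`, `(B)_n ⟹ (UC-hull)_n`), `…GHConjecture` (`UCHullNonneg n`, `(UC-hull)_n ⟹ (GH)_n`), `…PsiSym`
(the injective polarisation `polar`) and `…PhiCapClosedForm` (the closed form at a cap, used here only for the anchor `Φ_{k+1}(1_{star}) = k!`).

THE HOMOGENISED FUNCTIONAL.  `phiHom n m s := Σ_{π ⊢ [n]} (−1)^{|π|−1} s^{n−|π|} ∏_{B∈π} (|B|−1)!·m(B)` over any commutative ring (`phiHom_one`:
`phiHom n m 1 = Φ_n(m)`; `phiHom_smul`: homogeneous of degree `n` in `(m, s)`; `map_phiHom`: commutes with ring homomorphisms).  The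
UNION-CLOSED CONE `K_n` is generated by the vectors `(1_𝒰, 1)`, `𝒰` union-closed `∋ univ`; its points are `(Σ_x a_x 1_{𝒰_x}, Σ_x a_x)`, `a ≥ 0`,
and `phiHom` at such a point is `s^n Φ_n(β/s)` — Sahi's functional at the hull point `β/s`.

**CONJECTURE (S) — sector stability** (`SectorStable n`, typed, never a fact): for two points `u, v` of `K_n` the polynomial
`t ↦ phiHom n (u + t v)` (real coefficients, degree `≤ n`) is either identically zero or has ALL ITS COMPLEX ROOTS IN THE CLOSED LEFT
HALF-PLANE `Re t ≤ 0`.  Equivalent forms (memo §1): (i) `Φ^hom_n(Σ_i z_i (1_{𝒰_i},1)) ≠ 0` whenever the non-zero complex weights `z_i` lie in a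
common open sector of aperture `π/2` (two-point ⟺ multi-point by convexity of `K_n`); (ii) for a PAIR of vertices the polynomial is
`Σ_s N_s t^s` with `N_s` the layer sums of (B) (`UCBernstein.layerSum`), so (S) says the layer polynomial is (weakly) HURWITZ-STABLE, i.e.
the edge polynomial `w ↦ Φ_n(w 1_𝒰 + (1−w) 1_𝒱)` has no zero in the open disc with diameter `[0,1]`; (iii) the coefficients of
`t ↦ phiHom n (u + t v)` are `binom(n,j)·p̃(u^{n−j}, v^j)`, the MIXED VALUES of the polarisation `p̃` of `Φ^hom_n` (`PsiSym.polar` up to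
normalisation), so (S) contains (B) for pairs (a Hurwitz polynomial with a positive coefficient has all coefficients `≥ 0`) and the
log-concavity-type Hurwitz determinant inequalities between mixed values.
EVIDENCE (memo §2; exact integer Hurwitz determinants, C engines `work/c/hurwitz*.c`, `kit_hs/hs.c`): vertex pairs EXHAUSTIVE on 3 and 4 points
(616 + 374 550 ordered orbit-pairs of type (1,1), 34 485 of type (1,0), and all 12 985 280 restricted pairs and 3 710 080 `W^{(z)}`
polynomials on 4 points): 0 failures; 600 000 random pairs on 5 points: 0 failures; cone segments between mixtures of up to 4 vertices:
3 900 (n=4), 2 000 (n=5), 400 (n=6), 60 (n=7): 0 failures, all strict; adversarial hill-climbing over cone segments (n = 4, 5) stays below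
the vertex-pair extremum; largest root angle `|arg(−t)|` = 76.2° on 4 points (aperture `π/2` has margin), decreasing on the structured bi-glued /
bi-principal families through n = 10; kit census j221863/j221865 (n = 5).  The per-element multi-affine refinements and the two-variable
half-plane property are FALSE (memo §2), so (S) is the natural strength.

**THEOREM `ucHullNonneg_of_sectorStable : SectorStable n → UCHullNonneg n`** (every `n`): if `Φ_n(β) < 0` at a hull point `β`, the real
polynomial `g(t) = phiHom n ((β,1) + t·(1_{star},1))` has `g(0) = Φ_n(β) < 0` and, by homogeneity and continuity at the anchor
`Φ_n(1_{star}) = (n−1)! > 0` (`phiSet_star`), `g(M) > 0` for some `M > 0`; the intermediate value theorem gives a root in `(0, M)`, i.e. a root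
with positive real part of a not identically vanishing cone polynomial — contradicting (S).  With `GHConjecture.gSystemNonneg_of_ucHullNonneg`:
(S)_n ⟹ (GH)_n = Sahi's `C_n` on the principal-cap stratum.
HONEST FRAMING: a typed conjecture and a proved reduction; (S), (B), `UCHullNonneg n` (n ≥ 8), Sahi's `C_k`, Kahn's Conjecture 5 and the master
theorem remain OPEN.  Axioms standard. [this work]
-/

noncomputable section

open scoped Classical

namespace Summit.CriticalPhenomena.PercolationContinuityZ3.Theorems

namespace Sector

open Finset Function
open Literature.Combinatorics.Sahi2008
open Literature.Combinatorics.Sahi2008.CycleForm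
open PrincipalCapBeta (phiSet)

/-! ### The homogenised functional over a commutative ring -/

section Ring

variable {R : Type*} [CommRing R] {n : ℕ}

/-- **The homogenisation of Sahi's functional**: `phiHom n m s = Σ_{π ⊢ [n]} (−1)^{|π|−1} · s^{n−|π|} · ∏_{B∈π} (|B|−1)!·m(B)`, over any
commutative ring (so that it can be evaluated at complex points and along polynomial paths). [this work] -/
def phiHom (n : ℕ) (m : Finset (Fin n) → R) (s : R) : R :=
  ∑ c : OrderedFinpartition n, (-1 : R) ^ (c.length - 1) *
    (s ^ (n - c.length) * ∏ j : Fin c.length, (((c.partSize j - 1).factorial : R) * m (PartitionForm.block c j)))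

/-- `phiHom` commutes with ring homomorphisms. [this work] -/
theorem map_phiHom {S : Type*} [CommRing S] (f : R →+* S) (m : Finset (Fin n) → R) (s : R) :
    f (phiHom n m s) = phiHom n (fun B => f (m B)) (f s) := by
  unfold phiHom
  simp only [map_sum, map_mul, map_pow, map_neg, map_one, map_prod, map_natCast]

/-- **Homogeneity of degree `n`**: `phiHom n (c·m) (c·s) = c^n · phiHom n m s`. [this work] -/
theorem phiHom_smul (m : Finset (Fin n) → R) (s c : R) :
    phiHom n (fun B => c * m B) (c * s) = c ^ n * phiHom n m s := by
  unfold phiHom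
  rw [mul_sum]
  refine sum_congr rfl fun π _ => ?_
  have hl : π.length ≤ n := π.length_le
  have e1 : ∏ j : Fin π.length, (((π.partSize j - 1).factorial : R) * (c * m (PartitionForm.block π j))) =
      c ^ π.length * ∏ j : Fin π.length, (((π.partSize j - 1).factorial : R) * m (PartitionForm.block π j)) := by
    rw [show c ^ π.length = ∏ _j : Fin π.length, c by rw [prod_const, card_univ, Fintype.card_fin], ← prod_mul_distrib]
    exact prod_congr rfl fun j _ => by ring
  rw [e1, mul_pow]
  have e2 : c ^ (n - π.length) * c ^ π.length = c ^ n := by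
    rw [← pow_add, Nat.sub_add_cancel hl]
  calc (-1 : R) ^ (π.length - 1) * (c ^ (n - π.length) * s ^ (n - π.length) *
        (c ^ π.length * ∏ j : Fin π.length, (((π.partSize j - 1).factorial : R) * m (PartitionForm.block π j))))
      = (c ^ (n - π.length) * c ^ π.length) * ((-1 : R) ^ (π.length - 1) *
          (s ^ (n - π.length) * ∏ j : Fin π.length, (((π.partSize j - 1).factorial : R) * m (PartitionForm.block π j)))) := by ring
    _ = _ := by rw [e2]

end Ring

variable {n : ℕ}

/-- At `s = 1` the homogenised functional is Sahi's functional `Φ_n`. [this work] -/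
theorem phiHom_one (m : Finset (Fin n) → ℝ) : phiHom n m 1 = phiSet n m := by
  unfold phiHom PrincipalCapBeta.phiSet
  refine sum_congr rfl fun π _ => ?_
  rw [one_pow, one_mul]

/-- Real points give real values: the complex `phiHom` at real data is the cast of the real one. [this work] -/
theorem phiHom_ofReal (m : Finset (Fin n) → ℝ) (s : ℝ) :
    phiHom n (fun B => (m B : ℂ)) (s : ℂ) = ((phiHom n m s : ℝ) : ℂ) := by
  rw [show (fun B => (m B : ℂ)) = fun B => Complex.ofRealHom (m B) from rfl,
    show ((s : ℝ) : ℂ) = Complex.ofRealHom s from rfl, ← map_phiHom]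
  rfl

/-! ### Cone points: mixtures of union-closed vertices with (complex) weights -/

/-- The `β`-coordinates of the cone point `Σ_x z_x · (1_{𝒰_x}, 1)`. [this work] -/
def conePt {R : Type*} [CommRing R] {α : Type} [Fintype α] (𝒰 : α → Finset (Finset (Fin n))) (z : α → R) :
    Finset (Fin n) → R :=
  fun S => ∑ x, z x * (if S ∈ 𝒰 x then 1 else 0)

/-- The cone polynomial of the pair of cone points with weights `a` and `b`, evaluated at a complex `t`:
`F(t) = phiHom n (Σ_x (a_x + t b_x) 1_{𝒰_x}) (Σ_x (a_x + t b_x))`. [this work] -/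
def coneFun {α : Type} [Fintype α] (𝒰 : α → Finset (Finset (Fin n))) (a b : α → ℝ) (t : ℂ) : ℂ :=
  phiHom n (conePt 𝒰 (fun x => ((a x : ℝ) : ℂ) + t * ((b x : ℝ) : ℂ))) (∑ x, (((a x : ℝ) : ℂ) + t * ((b x : ℝ) : ℂ)))

/-- The same polynomial on the real axis. [this work] -/
def coneFunReal {α : Type} [Fintype α] (𝒰 : α → Finset (Finset (Fin n))) (a b : α → ℝ) (t : ℝ) : ℝ :=
  phiHom n (conePt 𝒰 (fun x => a x + t * b x)) (∑ x, (a x + t * b x))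

/-- On the real axis the complex cone polynomial is the cast of the real one. [this work] -/
theorem coneFun_ofReal {α : Type} [Fintype α] (𝒰 : α → Finset (Finset (Fin n))) (a b : α → ℝ) (t : ℝ) :
    coneFun 𝒰 a b (t : ℂ) = ((coneFunReal 𝒰 a b t : ℝ) : ℂ) := by
  unfold coneFun coneFunReal
  rw [← phiHom_ofReal]
  congr 1
  · funext S
    unfold conePt
    push_cast
    refine sum_congr rfl fun x _ => ?_
    split_ifs <;> simp
  · push_cast
    rfl

/-! ### The conjecture -/

/-- **CONJECTURE (S) — SECTOR STABILITY of Sahi's functional on the union-closed cone.**  For union-closed families `𝒰_x ∋ univ`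
(`x ∈ α`, `α` finite) and two nonnegative weight vectors `a, b : α → ℝ` (two points `u = Σ a_x(1_{𝒰_x},1)`, `v = Σ b_x(1_{𝒰_x},1)` of the
cone `K_n`), the polynomial `t ↦ Φ^hom_n(u + t v)` is identically zero or all its complex zeros satisfy `Re t ≤ 0`.
Equivalently: `Φ^hom_n` does not vanish at complex combinations of union-closed vertices whose weights lie in a common open sector of
aperture `π/2`; for a pair of vertices: the layer polynomial `Σ_s N_s t^s` of (B) is Hurwitz-stable.  Implies `UCHullNonneg n`
(`ucHullNonneg_of_sectorStable`) and (B) for pairs.  A conjecture-valued definition, never a fact. [this work]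
[status: open; exhaustive on ≤ 4 points, sampled through 7 points] -/
@[conjecture] def SectorStable (n : ℕ) : Prop :=
  ∀ (α : Type) [Fintype α] (𝒰 : α → Finset (Finset (Fin n))),
    (∀ x, ∀ A ∈ 𝒰 x, ∀ A' ∈ 𝒰 x, A ∪ A' ∈ 𝒰 x) → (∀ x, univ ∈ 𝒰 x) →
    ∀ (a b : α → ℝ), (∀ x, 0 ≤ a x) → (∀ x, 0 ≤ b x) →
      (∃ t : ℂ, coneFun 𝒰 a b t ≠ 0) → ∀ t : ℂ, coneFun 𝒰 a b t = 0 → t.re ≤ 0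

/-- **The real-axis consequence of (S)**: a not identically vanishing cone polynomial has no POSITIVE REAL zero. [this work] -/
theorem coneFunReal_ne_zero_of_pos (h : SectorStable n) {α : Type} [Fintype α] (𝒰 : α → Finset (Finset (Fin n)))
    (hUC : ∀ x, ∀ A ∈ 𝒰 x, ∀ A' ∈ 𝒰 x, A ∪ A' ∈ 𝒰 x) (htop : ∀ x, univ ∈ 𝒰 x) (a b : α → ℝ) (ha : ∀ x, 0 ≤ a x)
    (hb : ∀ x, 0 ≤ b x) {t₀ : ℝ} (h₀ : coneFunReal 𝒰 a b t₀ ≠ 0) {t : ℝ} (ht : 0 < t) : coneFunReal 𝒰 a b t ≠ 0 := by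
  intro hz
  have hne : ∃ t : ℂ, coneFun 𝒰 a b t ≠ 0 := ⟨(t₀ : ℂ), by rw [coneFun_ofReal]; exact_mod_cast h₀⟩
  have hzc : coneFun 𝒰 a b (t : ℂ) = 0 := by rw [coneFun_ofReal, hz]; simp
  have := h α 𝒰 hUC htop a b ha hb hne (t : ℂ) hzc
  rw [Complex.ofReal_re] at this
  linarith

/-! ### Continuity of the real cone polynomial -/

/-- The real cone polynomial is a continuous function of `t`. [this work] -/
theorem continuous_coneFunReal {α : Type} [Fintype α] (𝒰 : α → Finset (Finset (Fin n))) (a b : α → ℝ) :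
    Continuous (coneFunReal 𝒰 a b) := by
  unfold coneFunReal phiHom conePt
  refine continuous_finsetSum _ fun π _ => ?_
  refine continuous_const.mul (Continuous.mul ?_ ?_)
  · exact (continuous_finsetSum _ fun x _ => continuous_const.add (continuous_id.mul continuous_const)).pow _
  · refine continuous_finsetProd _ fun j _ => continuous_const.mul ?_
    exact continuous_finsetSum _ fun x _ => (continuous_const.add (continuous_id.mul continuous_const)).mul continuous_const

/-! ### The anchor: the star family -/

/-- The STAR of the last index (all sets containing it): a union-closed family containing `univ`. [this work] -/
def star (k : ℕ) : Finset (Finset (Fin (k + 1))) := univ.filter fun S => Fin.last k ∈ S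

/-- Membership in the star. [this work] -/
theorem mem_star {k : ℕ} {S : Finset (Fin (k + 1))} : S ∈ star k ↔ Fin.last k ∈ S := by
  unfold star; rw [mem_filter]; exact ⟨fun h => h.2, fun h => ⟨mem_univ _, h⟩⟩

/-- The star is union-closed. [this work] -/
theorem star_unionClosed {k : ℕ} : ∀ A ∈ star k, ∀ A' ∈ star k, A ∪ A' ∈ star k := by
  intro A hA A' _
  rw [mem_star] at hA ⊢
  exact mem_union_left _ hA

/-- The star contains `univ`. [this work] -/
theorem univ_mem_star {k : ℕ} : (univ : Finset (Fin (k + 1))) ∈ star k := mem_star.2 (mem_univ _)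

/-- **`Φ_{k+1}(1_{star}) = k!`** (the closed form at a cap, all other values zero: every permutation of `Fin k` contributes `1`). [this work] -/
theorem phiSet_star (k : ℕ) : phiSet (k + 1) (fun B => if B ∈ star k then (1 : ℝ) else 0) = (k.factorial : ℝ) := by
  have e1 : (fun B : Finset (Fin (k + 1)) => if B ∈ star k then (1 : ℝ) else 0) =
      fun B => if Fin.last k ∈ B then (1 : ℝ) else (fun B' : Finset (Fin (k + 1)) => if Fin.last k ∈ B' then (1 : ℝ) else 0) B := by
    funext B
    by_cases h : Fin.last k ∈ B <;> simp [mem_star, h]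
  rw [e1, PhiCapClosedForm.phiSet_cap_eq_sum_perm _ (if_pos (mem_univ _))]
  have e2 : ∀ σ : Equiv.Perm (Fin k), ∏ B ∈ orbits σ,
      (1 - (fun B' : Finset (Fin (k + 1)) => if Fin.last k ∈ B' then (1 : ℝ) else 0) (B.map Fin.castSuccEmb)) = 1 := by
    intro σ
    refine prod_eq_one fun B _ => ?_
    have hB : Fin.last k ∉ B.map Fin.castSuccEmb := fun h => by
      obtain ⟨x, _, hx⟩ := mem_map.1 h
      exact Fin.castSucc_ne_last x hx
    simp only [hB, if_false, sub_zero]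
  rw [sum_congr rfl fun σ _ => e2 σ, sum_const, card_univ, Fintype.card_perm, Fintype.card_fin]
  simp

/-! ### (S) ⟹ (UC-hull) -/

/-- The mixture `β = Σ_x w_x 1_{𝒰_x}` extended by the anchor family with weight `0`, read at weights `a + t·b` with `a = (w, 0)`, `b = (0, 1)`:
at `t = 0` it is `β` and the `s`-coordinate is `Σ w_x = 1`. Bookkeeping lemma for the `Option`-indexed family. [this work] -/
theorem coneFunReal_option_zero {k : ℕ} {α : Type} [Fintype α] (w : α → ℝ) (hw1 : ∑ x, w x = 1)
    (𝒰 : α → Finset (Finset (Fin (k + 1)))) :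
    coneFunReal (fun o : Option α => o.elim (star k) 𝒰) (fun o => o.elim 0 w) (fun o => o.elim 1 (fun _ => 0)) 0 =
      phiSet (k + 1) (fun S => ∑ x, w x * (if S ∈ 𝒰 x then (1 : ℝ) else 0)) := by
  unfold coneFunReal conePt
  simp only [zero_mul, add_zero]
  rw [Fintype.sum_option]
  simp only [Option.elim]
  rw [zero_add, hw1, phiHom_one]
  congr 1
  funext S
  rw [Fintype.sum_option]
  simp

/-- The same family read at weights `b + δ·a` (anchor first): at `δ = 0` it is the anchor vertex `1_{star}`, `s = 1`. [this work] -/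
theorem coneFunReal_option_swap_zero {k : ℕ} {α : Type} [Fintype α] (w : α → ℝ)
    (𝒰 : α → Finset (Finset (Fin (k + 1)))) :
    coneFunReal (fun o : Option α => o.elim (star k) 𝒰) (fun o => o.elim 1 (fun _ => 0)) (fun o => o.elim 0 w) 0 =
      (k.factorial : ℝ) := by
  unfold coneFunReal conePt
  simp only [zero_mul, add_zero]
  rw [Fintype.sum_option]
  simp only [Option.elim, sum_const_zero, add_zero]
  rw [phiHom_one, ← phiSet_star k]
  congr 1
  funext S
  rw [Fintype.sum_option]
  simp

/-- Homogeneity read on the two parametrisations: `g(M) = M^{n}·f(1/M)` for `M ≠ 0`, where `g(t)` uses weights `a + t b` and `f(δ)` uses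
`b + δ a`. [this work] -/
theorem coneFunReal_swap {α : Type} [Fintype α] (𝒰 : α → Finset (Finset (Fin n))) (a b : α → ℝ) {M : ℝ} (hM : M ≠ 0) :
    coneFunReal 𝒰 a b M = M ^ n * coneFunReal 𝒰 b a M⁻¹ := by
  unfold coneFunReal
  rw [← phiHom_smul]
  congr 1
  · funext S
    unfold conePt
    rw [mul_sum]
    refine sum_congr rfl fun x _ => ?_
    have : M * (b x + M⁻¹ * a x) = a x + M * b x := by field_simp; ring
    rw [← mul_assoc, this]
  · rw [mul_sum]
    refine sum_congr rfl fun x _ => ?_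
    field_simp
    ring

/-- **(S)_n ⟹ (UC-hull)_n.**  If Sahi's functional were negative at a hull point `β`, the cone polynomial through `(β,1)` and the anchor
`(1_{star},1)` — negative at `0`, positive far out by homogeneity and continuity at the anchor value `(n−1)! > 0` — would have a positive real
zero by the intermediate value theorem, contradicting sector stability. [this work] -/
theorem ucHullNonneg_of_sectorStable (h : SectorStable n) : GHConjecture.UCHullNonneg n := by
  cases n with
  | zero => exact UCBernstein.ucHullNonneg_zero
  | succ k =>
    intro α _ w 𝒰 hw0 hw1 hUC htop
    by_contra hneg
    replace hneg : phiSet (k + 1) (fun S => ∑ x, w x * (if S ∈ 𝒰 x then (1 : ℝ) else 0)) < 0 := lt_of_not_ge hneg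
    -- the extended family and the two weight vectors
    set 𝒰' : Option α → Finset (Finset (Fin (k + 1))) := fun o => o.elim (star k) 𝒰 with h𝒰'
    set a : Option α → ℝ := fun o => o.elim 0 w with ha
    set b : Option α → ℝ := fun o => o.elim 1 (fun _ => 0) with hb
    have hUC' : ∀ x, ∀ A ∈ 𝒰' x, ∀ A' ∈ 𝒰' x, A ∪ A' ∈ 𝒰' x := by
      rintro (_ | x)
      · exact star_unionClosed
      · exact hUC x
    have htop' : ∀ x, univ ∈ 𝒰' x := by
      rintro (_ | x)
      · exact univ_mem_star
      · exact htop x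
    have ha0 : ∀ x, 0 ≤ a x := by rintro (_ | x); exacts [le_rfl, hw0 x]
    have hb0 : ∀ x, 0 ≤ b x := by rintro (_ | x); exacts [zero_le_one, le_rfl]
    -- g(t) := cone polynomial with weights a + t b ; g(0) = Φ(β) < 0
    have hg0 : coneFunReal 𝒰' a b 0 < 0 := by
      rw [h𝒰', ha, hb, coneFunReal_option_zero w hw1 𝒰]; exact hneg
    -- f(δ) := cone polynomial with weights b + δ a ; f(0) = k! > 0, so f(δ) > 0 for some δ > 0
    have hf0 : 0 < coneFunReal 𝒰' b a 0 := by
      rw [h𝒰', ha, hb, coneFunReal_option_swap_zero w 𝒰]; exact_mod_cast Nat.factorial_pos k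
    have hfc : Continuous (coneFunReal 𝒰' b a) := continuous_coneFunReal 𝒰' b a
    obtain ⟨δ, hδ, hfδ⟩ : ∃ δ : ℝ, 0 < δ ∧ 0 < coneFunReal 𝒰' b a δ := by
      have hev : ∀ᶠ t in nhds (0 : ℝ), 0 < coneFunReal 𝒰' b a t :=
        (hfc.tendsto 0).eventually (eventually_gt_nhds hf0)
      obtain ⟨ε, hε, hball⟩ := Metric.eventually_nhds_iff.1 hev
      refine ⟨ε / 2, by linarith, hball ?_⟩
      rw [Real.dist_eq, sub_zero, abs_of_pos (by linarith)]
      linarith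
    -- g(1/δ) = δ^{-(k+1)} f(δ) > 0
    have hM : 0 < δ⁻¹ := inv_pos.2 hδ
    have hgM : 0 < coneFunReal 𝒰' a b δ⁻¹ := by
      rw [coneFunReal_swap 𝒰' a b hM.ne', inv_inv]
      exact mul_pos (pow_pos hM _) hfδ
    -- intermediate value theorem on [0, 1/δ]
    have hgc : Continuous (coneFunReal 𝒰' a b) := continuous_coneFunReal 𝒰' a b
    have hivt := intermediate_value_Icc hM.le hgc.continuousOn
    obtain ⟨t, ht, htz⟩ : ∃ t ∈ Set.Icc (0 : ℝ) δ⁻¹, coneFunReal 𝒰' a b t = 0 :=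
      hivt ⟨hg0.le, hgM.le⟩
    have htpos : 0 < t := by
      rcases eq_or_lt_of_le ht.1 with h0 | h0
      · rw [← h0] at htz; linarith
      · exact h0
    exact coneFunReal_ne_zero_of_pos h 𝒰' hUC' htop' a b ha0 hb0 hg0.ne htpos htz

/-- **(S)_n ⟹ (GH)_n** (= Sahi's `C_n` on the principal-cap stratum). [this work] -/
theorem gSystemNonneg_of_sectorStable (h : SectorStable n) : GHConjecture.GSystemNonneg n :=
  GHConjecture.gSystemNonneg_of_ucHullNonneg (ucHullNonneg_of_sectorStable h)

end Sector

end Summit.CriticalPhenomena.PercolationContinuityZ3.Theorems
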